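import Summits.CriticalPhenomena.SAWScalingLimit.Theorems.SAWDevelopingMapObservableToSLEShortChordLocalityArchMass
import Summits.CriticalPhenomena.SAWScalingLimit.Theorems.SAWDevelopingMapObservableToSLEShortChordLocalityHelpers
import Literature.Probability.RandomPlanarGeometry.HexParafermionProofs
import Literature.Probability.RandomPlanarGeometry.HexParafermionTransport
import HarnessLib

/-!
# Crux `SAWDevelopingMap.ObservableToSLE` (stmt-CriticalPhenomena-10472), line
`floor-ratio-restriction-bootstrap`: lattice helpers for the mechanism stub `stub_restrictionCocycle`

Landing target:
`Summits/CriticalPhenomena/SAWScalingLimit/Theorems/SAWDevelopingMapObservableToSLERestrictionCocycleHelpersLattice.lean`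
(`--supports stmt-CriticalPhenomena-10472`).

The mechanism stub compares the critical partition functions `Z_Λ(a, z) = Σ_{γ ⊂ Λ : a → z} x_c^{ℓ(γ)}`
of two nested admissible families `Λ' δ ⊆ Λ δ` through a floor point `s` near the root `a`.  This file
provides the lattice facts it consumes:

* geometry of the vertical floor mid-edges `s_y = {(y - e₁, 1), (y, 0)}` (`re_hexMidpoint_floorEdge`,
  `dist_hexMidpoint_floorEdge`, `dist_hexCenter_hexMidpoint_le`), and the identification of a
  boundary mid-edge of an exact half-lattice as such a floor mid-edge (`exists_eq_floorEdge_of_rows`);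
* existence of a self-avoiding walk between two distinct boundary mid-edges of a connected domain
  (`nonempty_hexMidEdgeSAW_of_preconnected`);
* the near/far splitting of the exact restriction deficit
  (`archMass_le_archMass_add_farMass`: `Z_Λ(s,t) ≤ Z_{Λ'}(s,t) + far mass` as soon as every vertex of
  `Λ` closer than `R` to `mid s` lies in `Λ'`);
* **deterministic winding of floor-to-floor walks** (`norm_hexParafermionicObservable_floorEdge`): for
  `Λ` in the rows `≥ x₁` the winding of every walk `s_x → s_y` (`y₁ = x₁`, `y ≠ x`) is `∓π`, so that
  `‖F(s_y)‖ = Z_Λ(s_x, s_y)` for the parafermionic observable at `σ = 5/8` (Duminil-Copin–Smirnov's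
  evaluation of the winding to the part `α ∖ {a}` of the strip boundary, `HV.pturn_of_isAlphaDart`,
  transported through the standard floor chart of the sibling arch-mass file).
-/

noncomputable section

open scoped BigOperators Classical
open Literature.Probability.LatticeModels (HexVertex hexGraph hexCenter triEmbed triZeta Site
  triZeta_re triZeta_im)
open Literature.Probability.RandomPlanarGeometry
open Literature.Probability.RandomPlanarGeometry.SAW
open Literature.Probability.RandomPlanarGeometry.SAW.HV
open Literature.Probability.Percolation (hexCenter_im hexCenter_re)

namespace Summit.CriticalPhenomena.SAWScalingLimit.Theorems.ObservableToSLE.FloorRatio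

/-! ### Geometry of floor mid-edges -/

/-- **The real part of a floor midpoint.**  The midpoint of the vertical floor mid-edge
`s_y = {(y - e₁, 1), (y, 0)}` has real part `y₀ + y₁/2 + 1/2`. [folklore] -/
theorem re_hexMidpoint_floorEdge (y : Site 2) :
    (hexMidpoint s((y - Pi.single 1 1, 1), (y, 0))).re = (y 0 : ℝ) + (y 1 : ℝ) / 2 + 1 / 2 := by
  rw [hexMidpoint_mk, Complex.div_ofNat_re, Complex.add_re, hexCenter_re, hexCenter_re]
  simp only [Pi.sub_apply, Pi.single_eq_same, Int.cast_sub, Int.cast_one, Fin.isValue,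
    Fin.val_one, Nat.cast_one, Fin.val_zero, Nat.cast_zero,
    Pi.single_eq_of_ne (show (0 : Fin 2) ≠ 1 by decide), sub_zero]
  ring

/-- **Distances along the floor.**  Two floor midpoints of the same row `x₁ = y₁` are at distance
`|x₀ - y₀|`. [folklore] -/
theorem dist_hexMidpoint_floorEdge (x y : Site 2) (h : y 1 = x 1) :
    dist (hexMidpoint s((x - Pi.single 1 1, 1), (x, 0)))
      (hexMidpoint s((y - Pi.single 1 1, 1), (y, 0))) = |((x 0 - y 0 : ℤ) : ℝ)| := by
  rw [Complex.dist_eq, Complex.norm_def, Complex.normSq_apply, Complex.sub_re, Complex.sub_im,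
    re_hexMidpoint_floorEdge, re_hexMidpoint_floorEdge, im_hexMidpoint_floorEdge,
    im_hexMidpoint_floorEdge, h]
  have : ((x 0 : ℝ) + (x 1 : ℝ) / 2 + 1 / 2 - ((y 0 : ℝ) + (x 1 : ℝ) / 2 + 1 / 2)) =
      ((x 0 - y 0 : ℤ) : ℝ) := by push_cast; ring
  rw [this, sub_self, mul_zero, add_zero, Real.sqrt_mul_self_eq_abs]

/-- **An endpoint of an edge is close to its midpoint**: for an edge `e` of the hexagonal lattice
and `w ∈ e`, `dist (c_w, mid e) ≤ 1/2` (the edge length is `1/√3`). [folklore] -/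
theorem dist_hexCenter_hexMidpoint_le {e : Sym2 HexVertex} (he : e ∈ hexGraph.edgeSet)
    {w : HexVertex} (hw : w ∈ e) : dist (hexCenter w) (hexMidpoint e) ≤ 1 / 2 := by
  -- write `e = {w, w'}` with `w ∼ w'`
  obtain ⟨w', hww'⟩ : ∃ w', e = s(w, w') := by
    induction e using Sym2.ind with
    | h p q =>
      rcases Sym2.mem_iff.1 hw with rfl | rfl
      · exact ⟨q, rfl⟩
      · exact ⟨p, Sym2.eq_swap⟩
  subst hww'
  have hadj : hexGraph.Adj w w' := (SimpleGraph.mem_edgeSet hexGraph).1 he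
  have key : ∀ (u v : HexVertex), hexGraph.Adj u v → u.2 = 0 →
      dist (hexCenter u) (hexCenter v) ^ 2 = 1 / 3 := by
    rintro ⟨p, i⟩ ⟨q, j⟩ h hi
    simp only at hi
    subst hi
    rw [hexGraph_adj_iff_coord] at h
    rcases h with ⟨-, hj, hc⟩ | ⟨h1, -⟩
    · subst hj
      rw [Complex.dist_eq, Complex.sq_norm, Complex.normSq_apply, Complex.sub_re, Complex.sub_im,
        hexCenter_re, hexCenter_re, hexCenter_im, hexCenter_im]
      have h3 : Real.sqrt 3 * Real.sqrt 3 = 3 := Real.mul_self_sqrt (by norm_num)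
      simp only [Fin.isValue, Fin.val_zero, Nat.cast_zero, Fin.val_one, Nat.cast_one]
      rcases hc with ⟨h0, h1⟩ | ⟨h0, h1⟩ | ⟨h0, h1⟩
      · rw [h0, h1]; ring_nf; nlinarith [h3]
      · rw [h0, h1]; push_cast; ring_nf; nlinarith [h3]
      · rw [h0, h1]; push_cast; ring_nf; nlinarith [h3]
    · exact absurd h1 (by decide)
  have hd : dist (hexCenter w) (hexCenter w') ^ 2 = 1 / 3 := by
    rcases Fin.exists_fin_two.1 ⟨w.2, rfl⟩ with h0 | h1
    · exact key w w' hadj h0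
    · have h0 : w'.2 = 0 := by
        obtain ⟨p, i⟩ := w
        obtain ⟨q, j⟩ := w'
        simp only at h1 ⊢
        subst h1
        rw [hexGraph_adj_iff_coord] at hadj
        rcases hadj with ⟨h, -⟩ | ⟨-, h, -⟩
        · exact absurd h (by decide)
        · exact h
      rw [dist_comm]
      exact key w' w hadj.symm h0
  have hmid : dist (hexCenter w) (hexMidpoint s(w, w')) = dist (hexCenter w) (hexCenter w') / 2 := by
    rw [hexMidpoint_mk, Complex.dist_eq, Complex.dist_eq,
      show hexCenter w - (hexCenter w + hexCenter w') / 2 = (hexCenter w - hexCenter w') / 2 by ring,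
      norm_div]
    norm_num
  rw [hmid]
  have hnn : 0 ≤ dist (hexCenter w) (hexCenter w') := dist_nonneg
  nlinarith [hd, hnn]

/-- **Boundary mid-edges of an exact half-lattice are vertical floor mid-edges.**  If `e` is a
boundary mid-edge of `Λ` and membership in `Λ` of both endpoints of `e` is decided by the row
(`w ∈ Λ ↔ m ≤ row w`), then `e = s_y = {(y - e₁, 1), (y, 0)}` for a cell `y` of the row `m`.
[cite: DuminilCopinSmirnov2012, §3 (the bottom boundary α of the strip)] -/
theorem exists_eq_floorEdge_of_rows {Λ : Finset HexVertex} {m : ℤ} {e : Sym2 HexVertex}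
    (he : e ∈ hexDomainBoundary Λ) (hrows : ∀ w ∈ e, (w ∈ Λ ↔ m ≤ w.1 1)) :
    ∃ y : Site 2, y 1 = m ∧ e = s((y - Pi.single 1 1, 1), (y, 0)) := by
  obtain ⟨he', u, v, rfl, hv, hu⟩ := he
  have hadj : hexGraph.Adj u v := (SimpleGraph.mem_edgeSet hexGraph).1 he'
  have hvrow : m ≤ v.1 1 := (hrows v (Sym2.mem_mk_right u v)).1 hv
  have hurow : u.1 1 < m := by
    by_contra h
    exact hu ((hrows u (Sym2.mem_mk_left u v)).2 (not_lt.1 h))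
  obtain ⟨p, i⟩ := u
  obtain ⟨q, j⟩ := v
  simp only at hvrow hurow
  rw [hexGraph_adj_iff_coord] at hadj
  rcases hadj with ⟨hi, hj, hc⟩ | ⟨hi, hj, hc⟩
  · exfalso
    rcases hc with ⟨-, h1⟩ | ⟨-, h1⟩ | ⟨-, h1⟩ <;> omega
  · subst hi hj
    rcases hc with ⟨h0, h1⟩ | ⟨h0, h1⟩ | ⟨h0, h1⟩
    · omega
    · omega
    · refine ⟨q, by omega, ?_⟩
      have hp : p = q - Pi.single 1 1 := by
        rw [site_two_eq_iff]
        simp only [Pi.sub_apply, Pi.single_eq_same, Fin.isValue,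
          Pi.single_eq_of_ne (show (0 : Fin 2) ≠ 1 by decide), sub_zero]
        omega
      rw [hp]

/-! ### Existence of a self-avoiding walk between two boundary mid-edges -/

/-- **Two distinct boundary mid-edges of a connected domain are joined by a self-avoiding walk.**
For `{u, w}`, `{u', w'}` with `u, u' ∉ Λ ∋ w, w'`, `u ∼ w`, take a simple path `w ⇝ w'` of the
induced graph: its edges have both endpoints in `Λ`, so they avoid the two boundary mid-edges.
[cite: DuminilCopinSmirnov2012, §1–§2 (walks between mid-edges)] -/
-- adapted from `nonempty_saw_of_preconnected` (Cruxes/BoundaryClosureR/Disproof.lean)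
theorem nonempty_hexMidEdgeSAW_of_preconnected {Λ : Finset HexVertex}
    (hconn : (hexGraph.induce ((Λ : Finset HexVertex) : Set HexVertex)).Preconnected)
    {u w u' w' : HexVertex} (huw : hexGraph.Adj u w) (hu : u ∉ Λ) (hw : w ∈ Λ)
    (hu' : u' ∉ Λ) (hw' : w' ∈ Λ) (hab : s(u, w) ≠ s(u', w')) :
    Nonempty (HexMidEdgeSAW Λ s(u, w) s(u', w')) := by
  classical
  obtain ⟨p⟩ := hconn ⟨w, hw⟩ ⟨w', hw'⟩
  set q := p.toPath with hq
  set L : List HexVertex := q.1.support.map Subtype.val with hL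
  have hLΛ : ∀ v ∈ L, v ∈ Λ := by
    intro v hv
    rw [hL, List.mem_map] at hv
    obtain ⟨x, -, rfl⟩ := hv
    exact x.2
  have hLnd : L.Nodup := (q.2.support_nodup).map Subtype.val_injective
  have hLch : L.IsChain hexGraph.Adj := by
    rw [hL, List.isChain_map]
    exact (SimpleGraph.Walk.isChain_adj_support _).imp fun a b h => by simpa using h
  have hLcons : L = w :: (q.1.support.tail.map Subtype.val) := by
    rw [hL, ← SimpleGraph.Walk.cons_tail_support]; rfl
  have hLne : L ≠ [] := by rw [hLcons]; exact List.cons_ne_nil _ _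
  have hhead : L.head? = some w := by rw [hLcons]; rfl
  have hlast : L.getLast? = some w' := by
    rw [hL, List.getLast?_map, List.getLast?_eq_some_getLast (SimpleGraph.Walk.support_ne_nil _),
      SimpleGraph.Walk.getLast_support]
    rfl
  have hmem : ∀ e ∈ List.zipWith (fun a b => s(a, b)) L L.tail, ∀ c ∈ e, c ∈ Λ := fun e he c hc =>
    hLΛ c (forall_mem_of_mem_edges _ e he c hc)
  have haL : s(u, w) ∉ List.zipWith (fun a b => s(a, b)) L L.tail := fun h =>
    hu (hmem _ h u (Sym2.mem_mk_left _ _))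
  have hbL : s(u', w') ∉ List.zipWith (fun a b => s(a, b)) L L.tail := fun h =>
    hu' (hmem _ h u' (Sym2.mem_mk_left _ _))
  refine ⟨{ verts := L
            subset := hLΛ
            nodup := hLnd
            isChain := hLch
            head_mem := fun v hv => ?_
            getLast_mem := fun v hv => ?_
            eq_of_nil := fun h => (hLne h).elim
            edges_nodup := fun _ => ?_
            fst_mem := ⟨(SimpleGraph.mem_edgeSet hexGraph).2 huw, w, Sym2.mem_mk_right _ _, hw⟩ }⟩
  · rw [hhead, Option.some_inj] at hv; subst hv; exact Sym2.mem_mk_right _ _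
  · rw [hlast, Option.some_inj] at hv; subst hv; exact Sym2.mem_mk_right _ _
  · refine List.nodup_append.2 ⟨List.nodup_cons.2 ⟨haL, edges_nodup hLnd⟩, List.nodup_singleton _, ?_⟩
    intro e he f hf
    rw [List.mem_singleton] at hf
    subst hf
    rcases List.mem_cons.1 he with rfl | he
    · exact hab
    · rintro rfl; exact hbL he

/-! ### The near/far splitting of the exact restriction deficit -/

/-- **Walks of `Λ` through a region contained in `Λ'` are walks of `Λ'`.**  If every vertex of `Λ`
satisfying `P` lies in `Λ'` (and the starting mid-edge is a mid-edge of `Ω(Λ')`), the walks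
`s → t` of `Λ` all of whose vertices satisfy `P` inject, with the same vertex list, into the walks
`s → t` of `Λ'`. [cite: LawlerSchrammWerner2004SAW, §3.4 ("SAW satisfies restriction")] -/
theorem exists_injective_of_forall_verts {Λ Λ' : Finset HexVertex} {s t : Sym2 HexVertex}
    (hs : s ∈ hexDomainMidEdges Λ') (P : HexVertex → Prop) (hP : ∀ v ∈ Λ, P v → v ∈ Λ') :
    ∃ ι : {γ : HexMidEdgeSAW Λ s t // ∀ v ∈ γ.verts, P v} → HexMidEdgeSAW Λ' s t,
      Function.Injective ι ∧ ∀ γ, (ι γ).verts = γ.1.verts := by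
  refine ⟨fun γ => ⟨γ.1.verts, fun v hv => hP v (γ.1.subset v hv) (γ.2 v hv), γ.1.nodup,
    γ.1.isChain, γ.1.head_mem, γ.1.getLast_mem, γ.1.eq_of_nil, γ.1.edges_nodup, hs⟩,
    fun γ₁ γ₂ hγ => ?_, fun _ => rfl⟩
  exact Subtype.ext (HexMidEdgeSAW.ext (by simpa using congrArg HexMidEdgeSAW.verts hγ))

/-- **Near/far splitting of the exact restriction deficit.**  If every vertex of `Λ` at distance
`< R` from `mid s` lies in `Λ'` (and `s` is a mid-edge of `Ω(Λ')`), then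
`Z_Λ(s,t) ≤ Z_{Λ'}(s,t) + (far mass)`, where the far mass is the `x_c`-mass of the walks `s → t`
of `Λ` having a vertex at distance `≥ R` from `mid s`: the other walks of `Λ` stay in the near
region, hence are walks of `Λ'`. [cite: LawlerSchrammWerner2004SAW, §3.4 ("SAW satisfies restriction")] -/
theorem archMass_le_archMass_add_farMass {Λ Λ' : Finset HexVertex} {s t : Sym2 HexVertex} {R : ℝ}
    (hs : s ∈ hexDomainMidEdges Λ')
    (hnear : ∀ v ∈ Λ, dist (hexCenter v) (hexMidpoint s) < R → v ∈ Λ') :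
    ∑ γ : HexMidEdgeSAW Λ s t, hexCriticalFugacity ^ γ.length ≤
      (∑ γ : HexMidEdgeSAW Λ' s t, hexCriticalFugacity ^ γ.length) +
      ∑ γ : HexMidEdgeSAW Λ s t,
        (if ∃ v ∈ γ.verts, R ≤ dist (hexCenter v) (hexMidpoint s)
          then hexCriticalFugacity ^ γ.length else 0) := by
  have h0 : 0 ≤ hexCriticalFugacity := hexCriticalFugacity_pos_lt_one.1.le
  set P : HexVertex → Prop := fun v => dist (hexCenter v) (hexMidpoint s) < R with hPdef
  obtain ⟨ι, hι, hιv⟩ := exists_injective_of_forall_verts (s := s) (t := t) hs P hnear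
  -- split each term into its near and far parts
  have hsplit : ∀ γ : HexMidEdgeSAW Λ s t, hexCriticalFugacity ^ γ.length =
      (if ∀ v ∈ γ.verts, P v then hexCriticalFugacity ^ γ.length else 0) +
      (if ∃ v ∈ γ.verts, R ≤ dist (hexCenter v) (hexMidpoint s)
        then hexCriticalFugacity ^ γ.length else 0) := by
    intro γ
    by_cases h : ∀ v ∈ γ.verts, P v
    · rw [if_pos h, if_neg, add_zero]
      rintro ⟨v, hv, hR⟩
      exact absurd (h v hv) (not_lt.2 hR)
    · rw [if_neg h, if_pos, zero_add]
      push Not at h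
      obtain ⟨v, hv, hR⟩ := h
      exact ⟨v, hv, not_lt.1 hR⟩
  rw [Finset.sum_congr rfl fun γ _ => hsplit γ, Finset.sum_add_distrib]
  refine add_le_add ?_ le_rfl
  -- the near part is a sum over the subtype, which injects into the walks of `Λ'`
  rw [← Finset.sum_filter, ← Finset.sum_subtype_eq_sum_filter]
  calc ∑ γ ∈ (Finset.univ : Finset (HexMidEdgeSAW Λ s t)).subtype (fun γ => ∀ v ∈ γ.verts, P v),
        hexCriticalFugacity ^ (γ : HexMidEdgeSAW Λ s t).length
      = ∑ γ ∈ (Finset.univ : Finset (HexMidEdgeSAW Λ s t)).subtype (fun γ => ∀ v ∈ γ.verts, P v),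
        hexCriticalFugacity ^ (ι γ).length := by
        refine Finset.sum_congr rfl fun γ _ => ?_
        rw [HexMidEdgeSAW.length, HexMidEdgeSAW.length, hιv]
    _ = ∑ γ' ∈ ((Finset.univ : Finset (HexMidEdgeSAW Λ s t)).subtype
          (fun γ => ∀ v ∈ γ.verts, P v)).map ⟨ι, hι⟩, hexCriticalFugacity ^ γ'.length := by
        rw [Finset.sum_map]; rfl
    _ ≤ ∑ γ' : HexMidEdgeSAW Λ' s t, hexCriticalFugacity ^ γ'.length :=
        Finset.sum_le_sum_of_subset_of_nonneg (Finset.subset_univ _) fun _ _ _ => pow_nonneg h0 _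

/-! ### Deterministic winding: `‖F(s_y)‖ = Z_Λ(s_x, s_y)` for floor exits -/

/-- No walk starts at `s_x` if its inner endpoint `(x, 0)` is not in `Λ` (for `Λ` in the rows
`≥ x₁`, the outer endpoint `(x - e₁, 1)` never is). [folklore] -/
theorem isEmpty_hexMidEdgeSAW_floorEdge_of_not_mem {Λ : Finset HexVertex} {x : Site 2}
    (hΛ : ∀ v ∈ Λ, x 1 ≤ v.1 1) (hx0 : (x, (0 : Fin 2)) ∉ Λ) (z : Sym2 HexVertex) :
    IsEmpty (HexMidEdgeSAW Λ s((x - Pi.single 1 1, 1), (x, 0)) z) := by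
  refine ⟨fun γ => ?_⟩
  obtain ⟨-, v, hv, hvΛ⟩ := γ.fst_mem
  rcases Sym2.mem_iff.1 hv with rfl | rfl
  · exact floorEdge_down_not_mem hΛ rfl hvΛ
  · exact hx0 hvΛ

/-- No walk of `Λ ⊆ rows ≥ x₁` runs from `s_x` to a different floor mid-edge `s_y` whose inner
endpoint `(y, 0)` is not in `Λ`. [folklore] -/
theorem isEmpty_hexMidEdgeSAW_floorEdge_of_not_mem_right {Λ : Finset HexVertex} {x y : Site 2}
    (hΛ : ∀ v ∈ Λ, x 1 ≤ v.1 1) (hy : y 1 = x 1) (hyx : y ≠ x) (hy0 : (y, (0 : Fin 2)) ∉ Λ) :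
    IsEmpty (HexMidEdgeSAW Λ s((x - Pi.single 1 1, 1), (x, 0)) s((y - Pi.single 1 1, 1), (y, 0))) := by
  refine ⟨fun γ => ?_⟩
  by_cases hnil : γ.verts = []
  · have heq := γ.eq_of_nil hnil
    have hmem : (y, (0 : Fin 2)) ∈ s((x - Pi.single 1 1, (1 : Fin 2)), (x, 0)) := by
      rw [heq]; exact Sym2.mem_mk_right _ _
    rcases Sym2.mem_iff.1 hmem with h | h
    · exact (show (0 : Fin 2) ≠ 1 by decide) (congrArg Prod.snd h)
    · exact hyx (congrArg Prod.fst h)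
  · have hlast := γ.getLast_mem _ (List.getLast?_eq_some_getLast hnil)
    have hin := γ.subset _ (List.getLast_mem hnil)
    rcases Sym2.mem_iff.1 hlast with h | h
    · exact floorEdge_down_not_mem hΛ hy (h ▸ hin)
    · exact hy0 (h ▸ hin)

/-- **Deterministic floor-to-floor winding: `‖F(s_y)‖ = Z_Λ(s_x, s_y)`.**  Let `Λ` lie in the rows
`≥ x₁` of the hexagonal lattice and let `s_y` (`y₁ = x₁`, `y ≠ x`) be another vertical floor
mid-edge.  Every self-avoiding walk `s_x → s_y` of `Λ` has winding `-π` if `y₀ > x₀` and `+π` if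
`y₀ < x₀` (Duminil-Copin–Smirnov: "the winding of any self-avoiding walk from `a` to the bottom part
of `α` is `-π` while the winding to the top part is `π`"), so the parafermionic observable with source
`s_x` at `x = x_c`, `σ = 5/8` has modulus equal to the critical mass at `s_y`:
`‖F(s_y)‖ = Σ_{γ ⊂ Λ : s_x → s_y} x_c^{ℓ(γ)}`. [cite: DuminilCopinSmirnov2012, proof of Lemma 2 (winding to α)] -/
theorem norm_hexParafermionicObservable_floorEdge (Λ : Finset HexVertex) (x y : Site 2)
    (hΛ : ∀ v ∈ Λ, x 1 ≤ v.1 1) (hy : y 1 = x 1) (hyx : y ≠ x) :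
    ‖hexParafermionicObservable Λ s((x - Pi.single 1 1, 1), (x, 0)) hexCriticalFugacity (5 / 8)
        s((y - Pi.single 1 1, 1), (y, 0))‖ =
      ∑ γ : HexMidEdgeSAW Λ s((x - Pi.single 1 1, 1), (x, 0)) s((y - Pi.single 1 1, 1), (y, 0)),
        hexCriticalFugacity ^ γ.length := by
  have h0 : 0 ≤ hexCriticalFugacity := hexCriticalFugacity_pos_lt_one.1.le
  -- degenerate cases: no walks at all
  by_cases hx0 : (x, (0 : Fin 2)) ∈ Λ
  swap
  · haveI := isEmpty_hexMidEdgeSAW_floorEdge_of_not_mem hΛ hx0 s((y - Pi.single 1 1, 1), (y, 0))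
    rw [hexParafermionicObservable, Fintype.sum_empty, Fintype.sum_empty, norm_zero]
  by_cases hy0 : (y, (0 : Fin 2)) ∈ Λ
  swap
  · haveI := isEmpty_hexMidEdgeSAW_floorEdge_of_not_mem_right hΛ hy hyx hy0
    rw [hexParafermionicObservable, Fintype.sum_empty, Fintype.sum_empty, norm_zero]
  -- the standard chart at `x` and its affine action
  set Φ : hexGraph ≃g hvGraph := hvIso.trans (shift (-(x 0)) (-(x 1))) with hΦ
  have haff : ∀ f, emb (pos (Φ f)) = (1 * 3) * hexCenter f + (1 * 0 + emb (3 * -(x 0), 3 * -(x 1))) :=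
    fun f => chart_trans (Φ := hvIso) (α := 3) (β := 0) emb_pos_toHV (shift (-(x 0)) (-(x 1)))
      (emb_pos_shift _ _) f
  have hα : (1 * 3 : ℂ) ≠ 0 := by norm_num
  have hΦy : Φ (y, 0) = (y 0 - x 0, y 1 - x 1, false) := rfl
  have hΦy' : Φ (y - Pi.single 1 1, 1) = (y 0 - x 0, y 1 - x 1 - 1, true) := by
    rw [hΦ, floorChart_apply]
    simp only [Pi.sub_apply, Pi.single_eq_same, Fin.isValue, decide_true]
    refine Prod.ext ?_ (Prod.ext ?_ rfl)
    · simp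
    · show y 1 - 1 - x 1 = y 1 - x 1 - 1
      ring
  -- both sides as sums over the coded walks
  have e : s((y - Pi.single 1 1, (1 : Fin 2)), (y, (0 : Fin 2))) =
      s((y, (0 : Fin 2)), (y - Pi.single 1 1, (1 : Fin 2))) := Sym2.eq_swap
  rw [e]
  set S : Finset (List HV) := (midWalks (Λ.map Φ.toEquiv.toEmbedding)).filter
      (fun P => finalDart P = (Φ (y, 0), Φ (y - Pi.single 1 1, 1)) ∨
        finalDart P = (Φ (y - Pi.single 1 1, 1), Φ (y, 0))) with hS
  have hF : hexParafermionicObservable Λ s((x - Pi.single 1 1, 1), (x, 0)) hexCriticalFugacity (5 / 8)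
      s((y, 0), (y - Pi.single 1 1, 1)) = ∑ P ∈ S, pwt P :=
    hexParafermionicObservable_eq_sum_pwt rfl (floorEdge_down_not_mem hΛ rfl) hx0 (adj_floorEdge x)
      (floorChart_down x) (floorChart_up x) haff hα (adj_floorEdge y).symm hy0
  have hZ : ∑ γ : HexMidEdgeSAW Λ s((x - Pi.single 1 1, 1), (x, 0)) s((y, 0), (y - Pi.single 1 1, 1)),
      hexCriticalFugacity ^ γ.length = ∑ P ∈ S, hexCriticalFugacity ^ mwLen P :=
    archMass_eq_sum_midWalks rfl (floorEdge_down_not_mem hΛ rfl) hx0 (adj_floorEdge x)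
      (floorChart_down x) (floorChart_up x) (adj_floorEdge y).symm hy0
  rw [hF, hZ]
  -- every coded walk is an `α`-walk of a strip, exiting in the column `y₀ - x₀`
  obtain ⟨T, L, -, hsub⟩ := exists_map_subset_stripV Λ x hΛ
  have hkey : ∀ P ∈ S, pturn P = -(3 * Int.sign (y 0 - x 0)) := by
    intro P hP
    obtain ⟨hPm, hfd⟩ := Finset.mem_filter.1 hP
    rw [mem_midWalks_iff] at hPm
    rw [hΦy, hΦy', hy, sub_self, zero_sub] at hfd
    obtain ⟨hαd, hcol⟩ := isAlphaDart_of_mem_floorFilter hΛ hy hyx hPm hfd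
    obtain ⟨-, hpt⟩ := pturn_of_isAlphaDart (hPm.mono hsub) hαd
    rw [hpt, hcol]
  -- hence the observable is `λ^k · Z`
  have hsum : ∑ P ∈ S, pwt P =
      lam ^ (-(3 * Int.sign (y 0 - x 0))) * ∑ P ∈ S, (hexCriticalFugacity : ℂ) ^ mwLen P := by
    rw [Finset.mul_sum]
    refine Finset.sum_congr rfl fun P hP => ?_
    rw [pwt, hkey P hP, mul_comm]
  rw [hsum, norm_mul, lam_zpow, Complex.norm_exp_ofReal_mul_I, one_mul]
  have hreal : ∑ P ∈ S, (hexCriticalFugacity : ℂ) ^ mwLen P =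
      ((∑ P ∈ S, hexCriticalFugacity ^ mwLen P : ℝ) : ℂ) := by
    push_cast; rfl
  rw [hreal, Complex.norm_real, Real.norm_of_nonneg (Finset.sum_nonneg fun _ _ => pow_nonneg h0 _)]

/-! ### Registered form (sub-goal of `stub_restrictionCocycle`) -/

/-- **Registered sub-goal `stub_restrictionCocycle_floorWinding`** (crux item
stmt-CriticalPhenomena-10472, line `floor-ratio-restriction-bootstrap`, mechanism stub
`stub_restrictionCocycle`): deterministic floor-to-floor winding — the modulus of the parafermionic
observable at a floor exit is the critical mass (`norm_hexParafermionicObservable_floorEdge`).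
[cite: DuminilCopinSmirnov2012, proof of Lemma 2 (winding to α)] -/
theorem stub_restrictionCocycle_floorWinding : ∀ (Λ : Finset HexVertex) (x y : Site 2),
    (∀ v ∈ Λ, x 1 ≤ v.1 1) → y 1 = x 1 → y ≠ x →
    ‖hexParafermionicObservable Λ s((x - Pi.single 1 1, 1), (x, 0)) hexCriticalFugacity (5 / 8)
        s((y - Pi.single 1 1, 1), (y, 0))‖ =
      ∑ γ : HexMidEdgeSAW Λ s((x - Pi.single 1 1, 1), (x, 0)) s((y - Pi.single 1 1, 1), (y, 0)),
        hexCriticalFugacity ^ γ.length :=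
  fun Λ x y hΛ hy hyx => norm_hexParafermionicObservable_floorEdge Λ x y hΛ hy hyx

end Summit.CriticalPhenomena.SAWScalingLimit.Theorems.ObservableToSLE.FloorRatio

end
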